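import Summits.AtomisticToContinuum.HydrodynamicLimit.Theses.AntiMazurCoboundaries
import Literature.MathematicalPhysics.KineticTheory.HardSphereEulerProofs
import Literature.Analysis.FluidPDE.HardSphereFlowJointMeasurable
import Summits.AtomisticToContinuum.HydrodynamicLimit.Theorems.JParityClosureOddContactSymmetryGibbsInvariance
import Summits.AtomisticToContinuum.HydrodynamicLimit.Theorems.ShearStressHalfDrude.Negative.WithoutOrth
import Summits.AtomisticToContinuum.HydrodynamicLimit.Theorems.ShearStressHalfDrude.Negative.FalseForAllN

/-!
# Line `fixed-budget-signed-hierarchy` — crux `AntiMazurCoboundaries.ShearStressHalfDrude`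
(stmt-AtomisticToContinuum-14136)

Skeleton (crux-plan, round 1; gen 2 = the gen-0 skeleton of this seat's predecessor, re-checked, with the
load-bearing stub CUT IN TWO along the panel's F1/F2 line: the φ ≡ 1 kinetic statement `FlatEnvelope`
(the bet) and the shared lemma `FrozenModulation` (φ-freezing = first-moment locality), typed once) of crux
idea `fixed-budget-signed-hierarchy` (ideator 1; triage r1-1/2/3: pass ×3), sharpened by the panel's findings
T1 (state C⁺ on `[A₀, ∞)` and glue the slow end), T2 (`σ₀` after the budget so the `O(σ⁶)` hydrodynamic tail
and the `O(σ³)` Enskog corrections are absorbed; no cap of `λ` by `ν(0)` is needed on the Boltzmann side —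
spectral theorem) and F1/F2 of triage-3/2 (the cutoff quantifier compactifies onto finitely many
single-observable statements by an exact `L²(γ)`-Lipschitz bound; frozen modulation is ONE shared lemma).

THE LEVER (`stub_windowBudget`, abstract, TRUE). A ONE-SIDED two-time envelope
`E[F(Φ_t)F(Φ_s)] ≤ E[F²](e^{-λ(t-s)} + η)` on `0 ≤ s ≤ t ≤ h` forces the window variance
`E[(h⁻¹∫₀ʰ F∘Φ)²] ≤ E[F²](2/(λh) + η)`; with `h = (8/λ)` (in units of the kinetic time `t₀ = ℓ/(σ²√θ)`) and
`η = ¼` this IS the crux's `½`. So the crux needs two-time control of ONE additive one-body observable only up to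
an ABSOLUTE kinetic horizon `S = 8/λ` and only within a FIXED additive budget `¼` — never `ε → 0`, never
`t → ∞`. The normalisation `E_{G_N}[F²] = (N+1)∫φ²∫g_A²dγ` is exact (`stub_staticShearVariance`, TRUE).

THE TRANSFER TARGET C⁺ (all-`A` two-time envelope at fixed small `σ`, pointwise in time, one-sided, budgeted)
is delivered by TWO regimes glued at an absolute hand-off cutoff `A₀(¼, S)` (`allCutoffEnvelope`, proved):
* AWAY FROM REST (`A ≥ A₀`): `EnvelopeAwayFromRest`, obtained (`stub_cutoffCompactification`, TRUE, size L)
  from the single-observable statement `SingleObservableEnvelope` (σ₀ after `(g, η, S)`, BEFORE the modulation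
  `φ`; `N₀` after `φ`), which is itself obtained (`stub_frozenModulation`, provable-grade, size L: diagonal
  translation invariance of `G_N` and of the dynamics + the exact one-velocity resampling identity + an
  `N`-uniform FIRST-MOMENT backward-cluster bound + the first-moment locality tail) from the φ ≡ 1 statement
  `FlatEnvelope` — `stub_flatEnvelope`, the OPEN, HARDEST stub = the fixed-ε reading of the
  Bodineau–Gallagher–Saint-Raymond–Simonella duality/pruning engine on the signed datum `G_N·Σ g(wᵢ)`
  (Koopman unitarity as a-priori bound, microscopic units, LOCALISED cluster restriction), in the quantifier
  order of the sibling rung `BoltzmannGreenKubo` (13985: `σ₀` after `(g, η, S)`) at `φ ≡ 1`; a second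
  candidate engine for the SAME statement is the sibling crux idea `enskog-projection-cycle-remainder`
  (one-body projection of the Koopman group = linearised Enskog operator exactly; closure defect fed by ring
  collisions only);
* SLOW END (`A ≤ A₀`, `σ₀` independent of `A`): `stub_slowEndEnvelope` (OPEN, size L/XL) = the companion card
  `velocity-resampling-cutoff` (near-rest tagged sphere + exact one-velocity resampling identity), which the
  additive-error engine cannot see (`‖g_A‖_∞/‖g_A‖₂ ≍ A^{-3/2}`, ideator-1 barrier note B1).

Composition (sorry-free): `allCutoffEnvelope : EnvelopeAwayFromRest → EnvelopeSlowEnd → (all-A envelope,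
λ := min, S := 8/λ, η := ¼, σ₀ := min)`; `shearStressHalfDrude_of_parts : WindowBudget → StaticShearVariance →
EnvelopeAwayFromRest → EnvelopeSlowEnd → (crux body)` (`σ₀ := min σ₁ ½`, clause (A) by the tree theorem
`isProbabilityMeasure_localGibbsLaw`; `τ := (8/λ)/(σ²√θ)` so that `h = τ(N+1)^{-1/3} = S·t₀`; window lemma at
`X = Phase N`, `μ = G_N`, `T = Φ.flow`, rate `λ/t₀`, good set `Φ.good` with `HardSphereFlow.measurable_flow_prod_torus`
and `measure_compl_good` + `G_N ≪ Liouville`; `E[F²](2/(λS) + ¼) = ½(N+1)∫φ²∫g_A²dγ` by `field_simp; ring`);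
`ShearStressHalfDrude_of : ShearStressHalfDrude` BY NAME from the six registered stubs
(`EnvelopeAwayFromRest := stub_cutoffCompactification (stub_frozenModulation stub_flatEnvelope)`). The
composition's `τ` does not depend on `(e₁, e₂, A, φ)`: the skeleton in fact proves the disprover's plausible
strengthening `ShearStressHalfDrudeUniform` (Disproof.lean §Further mutations).

DISPROOF USED (Cruxes/ShearStressHalfDrude/Disproof.lean, cycle 1 rev 2; BOTH landed Negative lemmas imported below):
`shearStressHalfDrudeAllN_false` = `Theorems/ShearStressHalfDrude/Negative/FalseForAllN.lean`
(`ShearStressHalfDrudeOneSphere.not_shearStressHalfDrudeAllN`; collisions / `N ≥ N₀` load-bearing) — honoured: the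
`∃ N₀` of the crux is the `∃ N₀` of `stub_flatEnvelope` / `stub_slowEndEnvelope`, whose decay is collisional (at
`N + 1 = 1` the envelope fails and no stub claims it; stubs 1, 2, 4, 5 hold for every `N` but claim no decay);
`WO.shearStressHalfDrudeWithoutOrth_false` =
`Theorems/ShearStressHalfDrude/Negative/WithoutOrth.lean` (centring load-bearing) — honoured four times: `e₁ ⊥ e₂`
is a hypothesis of `StaticShearVariance` (mean zero ⇒ no cross terms), of `EnvelopeAwayFromRest`/`EnvelopeSlowEnd`,
`stub_cutoffCompactification` turns it into the full `g ⊥ span(1, v, |v|²)` that `SingleObservableEnvelope` /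
`FlatEnvelope` demand (so no stub is an instance of the refuted `…WithoutOrth`, nor of the triage's
Mazur-with-momentum witness against `CascadeWindowBound`), and `stub_frozenModulation`'s resampling identity needs
`E_γ g = 0`; `ShearStressHalfDrudeTauUniformInSigma` (false on paper) — honoured: `τ = (8/λ)/(σ²√θ) ≍ 1/(σ²√θ)`;
`windowFraction_le_two_div` — the lever's `2/(λS)` is exactly this shape.
-/

noncomputable section

open MeasureTheory ProbabilityTheory Set Filter Topology
open scoped ENNReal InnerProductSpace

namespace Summit.AtomisticToContinuum.HydrodynamicLimit.Cruxes.ShearStressHalfDrude.FixedBudgetSignedHierarchy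

open Literature.MathematicalPhysics.KineticTheory (T3 V3 hsDiameter localGibbsLaw)
open Literature.Analysis.FluidPDE (HardSphereFlow Config)
open Summit.AtomisticToContinuum.HydrodynamicLimit.Theses.AntiMazurCoboundaries (ShearStressHalfDrude)

/-! ## Frame abbreviations (all reducible; the crux decl is matched by unfolding) -/

/-- Hard-sphere flows of `N + 1` spheres of reduced diameter `σ` on `𝕋³` (the crux's `Φ`). -/
abbrev Flow (σ : ℝ) (N : ℕ) : Type :=
  HardSphereFlow (Literature.Analysis.FluidPDE.Torus.geometry (Fin 3)) (hsDiameter σ N) (N + 1)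

/-- Phase space of `N + 1` spheres on `𝕋³`. -/
abbrev Phase (N : ℕ) : Type := Config (N + 1) (Fin 3) T3

/-- The flow-invariant global Gibbs law `G_N` of the crux (constant profiles `a, u₀, θ`). -/
abbrev gibbs (σ a θ : ℝ) (u₀ : V3) (N : ℕ) (Φ : Flow σ N) : Measure (Phase N) :=
  localGibbsLaw σ (fun _ => a) (fun _ => u₀) (fun _ => θ) N Φ

/-- The additive one-body observable `F(z) = Σᵢ φ(xᵢ) g((vᵢ − u₀)/√θ)` of the crux. -/
abbrev obs (θ : ℝ) (u₀ : V3) (φ : T3 → ℝ) (g : V3 → ℝ) (N : ℕ) (z : Phase N) : ℝ :=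
  ∑ i, φ (z i).1 * g ((Real.sqrt θ)⁻¹ • ((z i).2 - u₀))

/-- The crux's cutoff shear stress `g_A(w) = ⟨e₁,w⟩⟨e₂,w⟩(1 − smoothTransition(‖w‖²/A² − 1))`,
spelled exactly as the crux instantiates `g`. -/
abbrev cutoffStress (e₁ e₂ : V3) (A : ℝ) : V3 → ℝ := fun w =>
  inner ℝ e₁ w * inner ℝ e₂ w * (1 - Real.smoothTransition (‖w‖ ^ 2 / A ^ 2 - 1))

/-- Kinetic time unit `t₀ = ℓ/(σ²√θ)`, `ℓ = (N+1)^{-1/3}` (`= 1/(n d² √θ) = 4√π` mean free times; the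
unit in which the in-tree linearised hard-sphere operator generates the Boltzmann semigroup, cf.
`BoltzmannGreenKubo`). -/
abbrev kineticUnit (σ θ : ℝ) (N : ℕ) : ℝ :=
  ((N + 1 : ℕ) : ℝ) ^ (-(1 / 3 : ℝ)) / (σ ^ 2 * Real.sqrt θ)

/-- `‖g‖²_γ = ∫ g² d(stdGaussian)`. -/
abbrev gaussNormSq (g : V3 → ℝ) : ℝ := ∫ v, g v ^ 2 ∂(stdGaussian V3)

/-! ## Stub statements -/

/-- Statement of `stub_windowBudget` — **the fixed-budget window lemma** (abstract; TRUE, provable now).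
On a probability space, for a bounded measurable observable `F` and a time-dependent map `T` that is
jointly measurable on a co-null measurable set (the shape of Alexander's theorem:
`HardSphereFlow.measurable_flow_prod_torus`, `measure_compl_good`), a ONE-SIDED two-time envelope
`E[F(T_t)F(T_s)] ≤ E[F²](e^{-λ(t-s)} + η)` on `0 ≤ s ≤ t ≤ S` forces the window variance below
`E[F²](2/(λS) + η)`: expand the square, Fubini on `G × [0,S]²`, symmetry in `(s,t)`,
`2S⁻²∫₀^S∫₀^t (e^{-λ(t-s)} + η) ds dt = 2(S − (1−e^{-λS})/λ)/(λS²) + η ≤ 2/(λS) + η`; the conclusion is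
stated as a `lintegral` of `ENNReal.ofReal` (the crux's junk-free currency; the window average is
a.e.-measurable and bounded, `ofReal_integral_eq_lintegral_ofReal`). With `S = 8/λ`, `η = ¼` the factor is `½`. -/
def WindowBudget : Prop :=
  ∀ (X : Type) [MeasurableSpace X] (μ : Measure X) [IsProbabilityMeasure μ] (T : ℝ → X → X)
    (F : X → ℝ), Measurable F → (∃ C : ℝ, ∀ x, |F x| ≤ C) →
    (∃ G : Set X, MeasurableSet G ∧ μ Gᶜ = 0 ∧ Measurable fun p : G × ℝ => T p.2 (p.1 : X)) →
    ∀ (lam η S : ℝ), 0 < lam → 0 ≤ η → 0 < S →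
    (∀ s t : ℝ, 0 ≤ s → s ≤ t → t ≤ S →
      ∫ x, F (T t x) * F (T s x) ∂μ ≤ (∫ x, F x ^ 2 ∂μ) * (Real.exp (-(lam * (t - s))) + η)) →
    ∫⁻ x, ENNReal.ofReal ((S⁻¹ * ∫ t in (0 : ℝ)..S, F (T t x)) ^ 2) ∂μ
      ≤ ENNReal.ofReal ((∫ x, F x ^ 2 ∂μ) * (2 / (lam * S) + η))

/-- Statement of `stub_staticShearVariance` — **the static normalisation is exact** (TRUE, provable
now; verified on paper by two refuter passes and the standing disprover): under the constant-profile
Gibbs law `G_N` (`σ ≤ ½`, any flow) the velocities are i.i.d. standard Gaussian in the peculiar frame and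
independent of the positions, `g_A` is odd under the reflection `w ↦ w − 2⟨ê₁,w⟩ê₁` (this is where
`e₁ ⊥ e₂` enters: centring), and the one-particle position marginal is Haar on `𝕋³`; hence
`E_{G_N}[F²] = (N+1)(∫φ²)(∫g_A² dγ)` with NO `O(σ³)` correction. -/
def StaticShearVariance : Prop :=
  ∀ (a θ : ℝ) (u₀ : V3), 0 < a → 0 < θ → ∀ σ : ℝ, 0 < σ → σ ≤ 1 / 2 →
    ∀ (N : ℕ) (Φ : Flow σ N) (e₁ e₂ : V3), inner ℝ e₁ e₂ = 0 → ∀ A : ℝ, 0 < A →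
    ∀ φ : T3 → ℝ, Continuous φ →
      ∫ z, obs θ u₀ φ (cutoffStress e₁ e₂ A) N z ^ 2 ∂(gibbs σ a θ u₀ N Φ)
        = ((N : ℝ) + 1) * (∫ x, φ x ^ 2) * gaussNormSq (cutoffStress e₁ e₂ A)

/-- Statement of `stub_flatEnvelope` — **fixed-budget, finite-horizon, one-sided kinetic validity for ONE
fast velocity observable, unmodulated (`φ ≡ 1`)** (OPEN — the BET of the line, hardest stub). For every
bounded continuous `g ⊥ span(1, v, |v|²)` in `L²(γ)` and every budget `η` and horizon `S` there is
`σ₀(g, η, S)` such that at every FIXED reduced density `σ < σ₀`, uniformly in `N ≥ N₀` and in the flow, the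
two-time covariance of `G = Σᵢ g(wᵢ)` over flow times `0 ≤ s ≤ t ≤ S·t₀` lies below the linearised-Boltzmann
envelope `(N+1)‖g‖²_γ (e^{-λ(t-s)/t₀} + η)`, `λ > 0` UNIVERSAL (the proved Baranger–Mouhot gap of the in-tree
`hardSphereLinearizedOp`: `⟨g, e^{tL}g⟩_γ ≤ e^{-λt}‖g‖²` for every `g ⊥` invariants by the spectral theorem).
At `s = t` it is the exact static identity with room `η`; at `N + 1 = 1` it is FALSE (free flight, Disproof
`shearStressHalfDrudeAllN_false`) — the `∃ N₀` and the collisions are load-bearing. It is the φ ≡ 1, pointwise,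
one-sided, budgeted twin of the dilute-corner rung `BoltzmannGreenKubo` (13985: same order `σ₀` after
`(g, η, S)`, but there a two-sided Green–Kubo WINDOW identification): the fixed-ε reading of the BGSS
duality–pruning engine on the signed datum `G_N·Σg(wᵢ)` with Koopman unitarity as the a-priori bound, in
microscopic units, with the global cluster restriction LOCALISED (the card's one new estimate); alternative
engine: the one-body (Mori–Zwanzig) projection of the Koopman group, whose compressed generator is the
linearised Enskog operator exactly, plus a first-moment ring census for the closure defect (sibling crux idea
`enskog-projection-cycle-remainder`). -/
def FlatEnvelope : Prop :=
  ∀ (a θ : ℝ) (u₀ : V3), 0 < a → 0 < θ → ∃ lam : ℝ, 0 < lam ∧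
    ∀ g : V3 → ℝ, Continuous g → (∃ K : ℝ, ∀ v, |g v| ≤ K) →
    (∀ (c₀ c₂ : ℝ) (b : V3), ∫ v, g v * (c₀ + inner ℝ b v + c₂ * ‖v‖ ^ 2) ∂(stdGaussian V3) = 0) →
    ∀ (η S : ℝ), 0 < η → 0 < S → ∃ σ₀ : ℝ, 0 < σ₀ ∧ ∀ σ : ℝ, 0 < σ → σ < σ₀ →
    ∃ N₀ : ℕ, ∀ N : ℕ, N₀ ≤ N → ∀ (Φ : Flow σ N) (s t : ℝ), 0 ≤ s → s ≤ t →
      t ≤ S * kineticUnit σ θ N →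
      ∫ z, obs θ u₀ (fun _ => (1 : ℝ)) g N (Φ.flow t z) * obs θ u₀ (fun _ => (1 : ℝ)) g N (Φ.flow s z)
          ∂(gibbs σ a θ u₀ N Φ)
        ≤ ((N : ℝ) + 1) * gaussNormSq g * (Real.exp (-(lam * (t - s) / kineticUnit σ θ N)) + η)

/-- `SingleObservableEnvelope` — the MODULATED single-observable envelope (conclusion of
`stub_frozenModulation`, hypothesis of `stub_cutoffCompactification`): as `FlatEnvelope`, for
`F = Σφ(xᵢ)g(wᵢ)` with a continuous macroscopic modulation `φ`, the envelope scaled by `∫φ²`, with `σ₀`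
chosen BEFORE `φ` (it is `FlatEnvelope`'s `σ₀(g, η/2, S)` capped by the φ-free thresholds of the two
first-moment locality inputs) and `N₀` AFTER `φ` (modulus of continuity of `φ`, locality tail). -/
def SingleObservableEnvelope : Prop :=
  ∀ (a θ : ℝ) (u₀ : V3), 0 < a → 0 < θ → ∃ lam : ℝ, 0 < lam ∧
    ∀ g : V3 → ℝ, Continuous g → (∃ K : ℝ, ∀ v, |g v| ≤ K) →
    (∀ (c₀ c₂ : ℝ) (b : V3), ∫ v, g v * (c₀ + inner ℝ b v + c₂ * ‖v‖ ^ 2) ∂(stdGaussian V3) = 0) →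
    ∀ (η S : ℝ), 0 < η → 0 < S → ∃ σ₀ : ℝ, 0 < σ₀ ∧ ∀ σ : ℝ, 0 < σ → σ < σ₀ →
    ∀ φ : T3 → ℝ, Continuous φ →
    ∃ N₀ : ℕ, ∀ N : ℕ, N₀ ≤ N → ∀ (Φ : Flow σ N) (s t : ℝ), 0 ≤ s → s ≤ t →
      t ≤ S * kineticUnit σ θ N →
      ∫ z, obs θ u₀ φ g N (Φ.flow t z) * obs θ u₀ φ g N (Φ.flow s z) ∂(gibbs σ a θ u₀ N Φ)
        ≤ ((N : ℝ) + 1) * (∫ x, φ x ^ 2) * gaussNormSq g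
            * (Real.exp (-(lam * (t - s) / kineticUnit σ θ N)) + η)

/-- Statement of `stub_frozenModulation` — **frozen modulation** (provable-grade, size L; the shared
lemma F1/F2 of the triage panel, typed once): `FlatEnvelope → SingleObservableEnvelope`. On a kinetic window
positions move `O(S·t₀·√θ) = O(Sℓ/σ²)`, macroscopically `→ 0`, and pairs that are dynamically correlated
within `S·t₀` are macroscopically co-located, so the modulation FREEZES:
`E[F_φ(t)F_φ(s)] = (∫φ²)·E[F_1(t)F_1(s)] + o_N(1)·(N+1)‖g‖²`. Proof plan: (i) the signed pair measure
`M(A × B) = Σ_{i,j} E[g(wᵢ(u))1_A(xᵢ(u)) g(wⱼ(0))1_B(xⱼ(0))]`, `u = t − s` (stationarity: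
`measurePreserving_flow_localGibbsLaw_const`), is invariant under the DIAGONAL torus translation (`G_N` is, and
any two hard-sphere flows agree a.e.: `HardSphereFlow.flow_eq_ae_holds`, applied to `Φ` and its translate), so
by Fubini over the translation group `E[F_φ(u)F_φ(0)] = ∫ (φ ⋆ φ̃)(r) m(dr)` with `m` = image of `M` under
`(x, y) ↦ x − y`, `|φ ⋆ φ̃(r)| ≤ ∫φ²` (Cauchy–Schwarz) and `φ ⋆ φ̃(0) = ∫φ² `, `m(𝕋³) = E[F_1(u)F_1(0)]`; (ii) the
error `∫ (φ⋆φ̃(r) − ∫φ²) m(dr)` is bounded by `sup_{|r|≤δ}|φ⋆φ̃(r) − ∫φ²|·|m|(B_δ) + 2∫φ²·|m|(B_δᶜ)`; (iii) TOTAL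
VARIATION: by the exact one-velocity RESAMPLING identity (velocities i.i.d. `γ` and independent of positions
under `G_N`, `E_γ g = 0` from `g ⊥ 1`: `E[g(wⱼ)Ψ] = E[g(wⱼ)(Ψ − Ψ^{(j)})]`, `Ψ^{(j)}` computed with `wⱼ`
resampled) the off-diagonal part of `M` lives on pairs `j ⇝ i` (j influences i within `u`), whence
`|m|(𝕋³) ≤ (N+1)K²(1 + 4·E|BC_i(S t₀)|)` — INPUT P1: an `N`-uniform bound on the mean backward-cluster
cardinality `HardSphereFlow.meanBackwardClusterCard Φ G_N i 0 (S·t₀) ≤ C(S)` at fixed `σ < σ₀` (first-moment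
census of actual time-ordered collision chains under the invariant measure; Campbell/Palm + Gaussian moments;
no pseudo-trajectory expansion, so no Lanford radius); (iv) LOCALITY TAIL — INPUT P2: `|m|(B_δᶜ)/(N+1) → 0` as
`N → ∞` at fixed `σ, S, δ` (influence across a MACROSCOPIC distance `δ` within `S·t₀` needs chains of total
speed `≍ δσ²√θ(N+1)^{1/3}/S → ∞`: the first-moment form of the route item `InfluenceLocality` 13916, its stated
repair); (v) choose `δ(φ, g, η, S)` by continuity of `r ↦ φ⋆φ̃(r)` (`∫φ² > 0`, else `φ ≡ 0` and all is `0 ≤ 0`),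
then `N₀(δ, …)`; `FlatEnvelope` at budget `η/2` bounds the main term since `∫φ² ≥ 0`. P1 and P2 are φ-free,
so `σ₀` stays before `φ`; they are also the dynamical inputs of `stub_slowEndEnvelope`'s distinct part — land
them once as `--supports` helpers. -/
def FrozenModulation : Prop :=
  FlatEnvelope → SingleObservableEnvelope

/-- The envelope for the cutoff shear stresses AWAY FROM REST: `A ≥ A₀ > 0`, `σ₀` depending on
`(A₀, η, S)` only — uniform in the directions `e₁ ⊥ e₂`, the cutoff `A ≥ A₀` and (before `N₀`) the
modulation `φ`. Conclusion of `stub_cutoffCompactification`. -/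
def EnvelopeAwayFromRest : Prop :=
  ∀ (a θ : ℝ) (u₀ : V3), 0 < a → 0 < θ → ∃ lam : ℝ, 0 < lam ∧
    ∀ (A₀ η S : ℝ), 0 < A₀ → 0 < η → 0 < S → ∃ σ₀ : ℝ, 0 < σ₀ ∧ ∀ σ : ℝ, 0 < σ → σ < σ₀ →
    ∀ (e₁ e₂ : V3), inner ℝ e₁ e₂ = 0 → ∀ A : ℝ, A₀ ≤ A → ∀ φ : T3 → ℝ, Continuous φ →
    ∃ N₀ : ℕ, ∀ N : ℕ, N₀ ≤ N → ∀ (Φ : Flow σ N) (s t : ℝ), 0 ≤ s → s ≤ t →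
      t ≤ S * kineticUnit σ θ N →
      ∫ z, obs θ u₀ φ (cutoffStress e₁ e₂ A) N (Φ.flow t z)
          * obs θ u₀ φ (cutoffStress e₁ e₂ A) N (Φ.flow s z) ∂(gibbs σ a θ u₀ N Φ)
        ≤ ((N : ℝ) + 1) * (∫ x, φ x ^ 2) * gaussNormSq (cutoffStress e₁ e₂ A)
            * (Real.exp (-(lam * (t - s) / kineticUnit σ θ N)) + η)

/-- Statement of `stub_cutoffCompactification` — **compactification of the cutoff quantifier** (TRUE,
provable now; size L): `SingleObservableEnvelope → EnvelopeAwayFromRest`. (i) `g_{e₁,e₂,A} =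
‖e₁‖‖e₂‖ g_{ê₁,ê₂,A}` and both sides are 2-homogeneous in each `eᵢ` (`eᵢ = 0` is `0 ≤ 0`); (ii) every
`g_{ê₁,ê₂,A}` is bounded, continuous and `⊥ span(1, v, |v|²)` by parity (reflections along `ê₁`, `ê₂`;
uses `e₁ ⊥ e₂`); (iii) the two-time covariance is `L²(G_N)`-Lipschitz in `g` UNIFORMLY in `N, σ, Φ, s, t`:
`|Cov_t(F_k) − Cov_t(F_{k'})| ≤ (N+1)(∫φ²)(‖k‖_γ + ‖k'‖_γ)‖k − k'‖_γ` for centred `k, k'` (Cauchy–Schwarz,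
Koopman isometry = stationarity `measurePreserving_flow_localGibbsLaw_const`, and the exact static identity
`‖F_{φ⊗k}‖² = (N+1)∫φ²‖k‖²_γ`); (iv) the normalised family `{ĝ_{ê₁,ê₂,A} : (ê₁,ê₂) orthonormal, A ≥ A₀}`
is totally bounded in `L²(γ)` (continuous on the compact Stiefel manifold × `[A₀, ∞]`, `ĝ_A → ŵ₁ŵ₂` as
`A → ∞` by dominated convergence) — so a FINITE `η/4`-net of cutoffs `A_k < ∞` and directions serves all:
`σ₀ := min_k σ₀(g_k, η/2, S)`, `N₀ := N₀(g_k, φ)`. (= `CutoffContinuity`/`NetLipschitz` of the sibling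
cards, triage F1/F2.) -/
def CutoffCompactification : Prop :=
  SingleObservableEnvelope → EnvelopeAwayFromRest

/-- Statement of `stub_slowEndEnvelope` — **the slow end `A → 0` with `σ₀` NOT depending on `A`**
(OPEN, size L/XL; the content of the companion card `velocity-resampling-cutoff`, which this line needs
at an absolute hand-off `A₀(η, S)`): for `A ≤ A₀(η,S)` the envelope holds with `σ₀(η, S)`. Mechanism:
SELF part = a near-rest tagged sphere is a sitting duck relaxing at rate `≥ ν(0) > 0`
(`collisionFrequency_zero_pos`; `SlowBallPureLoss`: gain terms cost phase volume `O(A³)`, `g_A ⊥ 1, w`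
kills two Taylor orders of the partner loss), handled by the sign-split tilt `ρ± ≤ R_A·G_N` whose sup-norm
price `R_A ≍ A^{-3}` is repaid EXACTLY by the masses `m± ≍ A⁵`; DISTINCT part = exact one-velocity
resampling identity (`E_γ g_A = 0`, velocities i.i.d. under `G_N`) + `|g_A| ≤ 2A²`: only an `N`-uniform
first-moment forward-cluster bound at fixed `σ` over the horizon `S` is consumed, `A₀ ≍ (η/C(S))^{1/2}`.
Any `λ ≤ ν(0)` (in `t₀` units) works here; the composition takes `min` with the engine's `λ`. -/
def EnvelopeSlowEnd : Prop :=
  ∀ (a θ : ℝ) (u₀ : V3), 0 < a → 0 < θ → ∃ lam : ℝ, 0 < lam ∧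
    ∀ (η S : ℝ), 0 < η → 0 < S → ∃ A₀ : ℝ, 0 < A₀ ∧ ∃ σ₀ : ℝ, 0 < σ₀ ∧ ∀ σ : ℝ, 0 < σ → σ < σ₀ →
    ∀ (e₁ e₂ : V3), inner ℝ e₁ e₂ = 0 → ∀ A : ℝ, 0 < A → A ≤ A₀ → ∀ φ : T3 → ℝ, Continuous φ →
    ∃ N₀ : ℕ, ∀ N : ℕ, N₀ ≤ N → ∀ (Φ : Flow σ N) (s t : ℝ), 0 ≤ s → s ≤ t →
      t ≤ S * kineticUnit σ θ N →
      ∫ z, obs θ u₀ φ (cutoffStress e₁ e₂ A) N (Φ.flow t z)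
          * obs θ u₀ φ (cutoffStress e₁ e₂ A) N (Φ.flow s z) ∂(gibbs σ a θ u₀ N Φ)
        ≤ ((N : ℝ) + 1) * (∫ x, φ x ^ 2) * gaussNormSq (cutoffStress e₁ e₂ A)
            * (Real.exp (-(lam * (t - s) / kineticUnit σ θ N)) + η)

/-! ## Registered stubs -/

/-- STUB 1 (size M; TRUE, provable now — abstract measure theory: sections of the jointly measurable map on
`G × ℝ` are measurable, the window integral is measurable on `G` (`StronglyMeasurable.integral_prod_right'`, cf.
`HardSphereFlow.stronglyMeasurable_integral_comp_flow`), Fubini on `G × [0,S]²` for a bounded integrand,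
symmetry in `(s, t)`, `intervalIntegral` calculus of `∫₀^S∫₀^t e^{-λ(t-s)}`, `ofReal_integral_eq_lintegral_ofReal`).
No stationarity and no probability normalisation are used. Sources: this file; Disproof.lean `integral_window_eq`
(same Fubini pattern, proved); KipnisLandim1999 App. 1 (window variances). -/
theorem stub_windowBudget : WindowBudget := by
  sorry

/-- STUB 2 (size M; TRUE, provable now — the disintegration of the homogeneous Gibbs law: positions
`Z⁻¹𝟙_D dx` (translation invariant ⇒ uniform one-point marginal), velocities i.i.d. `localMaxwellian 1 θ u₀`,
so `w = (v−u₀)/√θ ∼ stdGaussian` (`lintegral_localGibbsMeasure`, `lintegral_gibbsWeight_mul`,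
`withDensity_localMaxwellian_eq_gaussMeasure` in HardSphereEulerProofs); `E_γ g_A = 0` by the reflection along
`ê₁` (needs `e₁ ⊥ e₂`); expand `F²` into diagonal + cross terms). Sources: Spohn1991 Part I §2.3; Disproof.lean
finding 1 (constants re-derived); refuter notes on the item (identity verified twice). -/
theorem stub_staticShearVariance : StaticShearVariance := by
  sorry

/-- STUB 3 (size XL; OPEN — the HARDEST, the line's bet: N-uniform kinetic validity of two-time one-body
covariances over a FINITE horizon `S·t₀` at FIXED small reduced density, with an additive budget `η` that need
not vanish, for ONE unmodulated velocity observable). Plan (card): BGSS duality/pruning expansion READ AT FIXED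
ε — sampling step `τ_s(S, η)` first, then `ε₀(S, η, τ_s)`; remainders = super-exponential trees (ε-free,
BGSSCPAM2023 Prop. 2.3, p. 16) + recollisions (`ε^{1/(8d)}`-powers × `C(S)`, BodineauEtAl2024 p. 34) + high
energies (Gaussian); datum = the SIGNED measure `G_N·Σg(wᵢ)` (linear hierarchy, `k`-marginals `k‖g‖`-bounded
because `E_γ g = 0`), a-priori bound = Koopman unitarity (`measurePreserving_flow_localGibbsLaw_const`);
microscopic units (torus side `(N+1)^{1/3} → ∞`, no periodic image in reach: `bgsr_lemma52_volume`); the ONE new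
estimate is the LOCALISATION of BGSS's global cluster restriction (Prop. 2.1, p. 11) to influence balls, paid
per particle through first-moment locality (inputs P1/P2 of `stub_frozenModulation`). Main part = linearised
Enskog, rate `χ_N(σ)·N/(N+1)·λ` with `χ_N = 1 + O(σ³)` (the `O(σ³)` and `O(1/N)` rate defects and the
`O(σ⁶(t/t_mf)^{-3/2})` hydrodynamic tail go into `η`, `N₀`) ≤ linearised Boltzmann envelope `e^{-λt}` (proved gap
`le_neg_maxwellianInner_hardSphereLinearizedOp_of_orthogonal_holds` + spectral theorem, uniformly in `g`).
Alternative engine for the same statement: sibling crux idea `enskog-projection-cycle-remainder` (exact finite-`N`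
Duhamel identity `c_N(t) = ⟨g, e^{ctL̂/t₀}g⟩ + ∫ρ_N`, closure defect fed by ring collisions, first-moment ring
census). False iff a hidden extensive charge overlaps a fast one-body `g` (route kill criterion,
`MazurBoundBallistic`). Dilute-corner shadow (σ₀ after η at φ ≡ 1, window form) = rung 13985.
Sources: BGSSCPAM2023 = arXiv:2012.03813 (Thm 1.1, Props 2.1–2.5, pp. 9–16); BodineauEtAl2024 = arXiv:2201.04514
(Thm 1.2, p. 34); VanbeijerenEtAl1980; BarangerMouhot2005 Thm 1.1; BodineauGallagherSaintRaymondInvent2016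
Lemma 5.2 / Prop. 5.3; PulvirentiSimonella2021; Spohn1991 §II.7. -/
theorem stub_flatEnvelope : FlatEnvelope := by
  sorry

/-- STUB 4 (size L; provable-grade — frozen modulation, the panel's shared lemma typed once:
`FlatEnvelope → SingleObservableEnvelope` by diagonal translation invariance (`G_N` + `HardSphereFlow.flow_eq_ae_holds`),
Fubini over the translation group, `|φ⋆φ̃| ≤ ∫φ²`, the exact one-velocity resampling identity, and two φ-free
FIRST-MOMENT dynamical inputs to be landed as `--supports` helpers: P1 = `N`-uniform mean backward-cluster bound
`meanBackwardClusterCard Φ G_N i 0 (S·t₀) ≤ C(S)` at fixed small `σ`; P2 = first-moment locality tail (influence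
across a macroscopic distance within a kinetic window is `o(N)` in expectation; repaired form of route item 13916).
Sources: TRIAGE-r1-3 F1/F2, TRIAGE-r1-2 §Panel concordance; Ideas/cutoff-compactness-net.md (`FrozenModulation`);
Alexander1975 / GST2013 Prop. 4.1.1 (`flow_eq_ae_holds`); AokiPulvirentiSimonellaTsuji2015 §1 (cluster cardinality);
Sinai1972, MarchioroPellegrinottiPresutti1975 (finite speed of influence); Spohn1991 Thm 1.2. -/
theorem stub_frozenModulation : FrozenModulation := by
  sorry

/-- STUB 5 (size L; TRUE, provable now — `L²(G_N)` Cauchy–Schwarz + Koopman isometry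
(`measurePreserving_flow_localGibbsLaw_const`) + the static identity `‖F_{φ⊗k}‖² = (N+1)∫φ²‖k‖²_γ` for centred
`k`; parity of `g_A` under the reflections along `ê₁`, `ê₂` (`MeasurePreserving` of a linear isometry for
`stdGaussian`); total boundedness of the normalised cutoff family in `L²(γ)` (dominated convergence in `A`,
compactness of the orthonormal-pair Stiefel manifold, `TotallyBounded`/`IsCompact.finite_cover_balls`);
2-homogeneity in each `eᵢ`). = `CutoffContinuity` (card velocity-resampling-cutoff) = `NetLipschitz` (card
cutoff-compactness-net), triage F1. Sources: TRIAGE-r1-3 F1 (quantifier check), TRIAGE-r1-2 (re-derivation). -/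
theorem stub_cutoffCompactification : CutoffCompactification := by
  sorry

/-- STUB 6 (size L/XL; OPEN — the slow end, content of the companion card `velocity-resampling-cutoff`; the three
exact steps (sign-split tilt, resampling identity, `SlowBallPureLoss`) were re-derived by all three triagers; the
dynamical inputs are tagged-grade: near-rest survival/relaxation at fixed `σ` and an `N`-uniform FIRST-MOMENT
forward-cluster bound over the horizon `S` (σ-free in `t₀` units) — the inputs P1/P2 of
`stub_frozenModulation` —, `A₀ ≍ (η/C(S))^{1/2}`). Sources: card Ideas/velocity-resampling-cutoff.md; TRIAGE-r1-2 (sharpened distinct-part estimate `≲ A⁹C(S)` vs `A⁷`);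
`collisionFrequency_zero_pos`, `hardSphereLinearizedOp` (tree); VanbeijerenEtAl1980 (tagged validity);
BodineauGallagherSaintRaymondInvent2016; Spohn1991 §II.8. -/
theorem stub_slowEndEnvelope : EnvelopeSlowEnd := by
  sorry

/-! ## Composition (sorry-free) -/

/-- Frame check (proved): `FlatEnvelope` is EXACTLY the `φ ≡ 1` instance of `SingleObservableEnvelope`
(`∫_{𝕋³} 1² = 1`), so `stub_frozenModulation` upgrades an instance to the whole and hides no strengthening
(an `example`, so that the file carries no orphan declaration). -/
example (h : SingleObservableEnvelope) : FlatEnvelope := by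
  intro a θ u₀ ha hθ
  obtain ⟨lam, hlam, H⟩ := h a θ u₀ ha hθ
  refine ⟨lam, hlam, fun g hg hK horth η S hη hS => ?_⟩
  obtain ⟨σ₀, hσ₀, Hσ⟩ := H g hg hK horth η S hη hS
  refine ⟨σ₀, hσ₀, fun σ hσ hσlt => ?_⟩
  obtain ⟨N₀, HN⟩ := Hσ σ hσ hσlt (fun _ => (1 : ℝ)) continuous_const
  refine ⟨N₀, fun N hN Φ s t hs hst ht => ?_⟩
  have hT3 : ∫ _x : T3, (1 : ℝ) ^ 2 = 1 := by simp
  have key := HN N hN Φ s t hs hst ht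
  rw [hT3, mul_one] at key
  exact key

/-- The cutoff stress is continuous. -/
theorem continuous_cutoffStress (e₁ e₂ : V3) (A : ℝ) : Continuous (cutoffStress e₁ e₂ A) := by
  refine ((continuous_const.inner continuous_id).mul (continuous_const.inner continuous_id)).mul
    (continuous_const.sub (Real.smoothTransition.continuous.comp ?_))
  fun_prop

/-- The cutoff stress is bounded: `|g_A(w)| ≤ 2A²‖e₁‖‖e₂‖` (it vanishes for `‖w‖² ≥ 2A²`). -/
theorem abs_cutoffStress_le (e₁ e₂ : V3) {A : ℝ} (hA : 0 < A) (w : V3) :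
    |cutoffStress e₁ e₂ A w| ≤ 2 * A ^ 2 * (‖e₁‖ * ‖e₂‖) := by
  simp only [cutoffStress]
  by_cases hw : 2 * A ^ 2 ≤ ‖w‖ ^ 2
  · have h1 : (1 : ℝ) ≤ ‖w‖ ^ 2 / A ^ 2 - 1 := by
      rw [le_sub_iff_add_le, le_div_iff₀ (by positivity)]
      linarith
    rw [Real.smoothTransition.one_of_one_le h1, sub_self, mul_zero, abs_zero]
    positivity
  · have hw : ‖w‖ ^ 2 < 2 * A ^ 2 := not_le.1 hw
    have hcut : |1 - Real.smoothTransition (‖w‖ ^ 2 / A ^ 2 - 1)| ≤ 1 := by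
      rw [abs_le]
      constructor
      · linarith [Real.smoothTransition.le_one (‖w‖ ^ 2 / A ^ 2 - 1)]
      · linarith [Real.smoothTransition.nonneg (‖w‖ ^ 2 / A ^ 2 - 1)]
    rw [abs_mul, abs_mul]
    calc |inner ℝ e₁ w| * |inner ℝ e₂ w| * |1 - Real.smoothTransition (‖w‖ ^ 2 / A ^ 2 - 1)|
        ≤ (‖e₁‖ * ‖w‖) * (‖e₂‖ * ‖w‖) * 1 := by
          gcongr
          · exact abs_real_inner_le_norm e₁ w
          · exact abs_real_inner_le_norm e₂ w
      _ = ‖w‖ ^ 2 * (‖e₁‖ * ‖e₂‖) := by ring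
      _ ≤ 2 * A ^ 2 * (‖e₁‖ * ‖e₂‖) := by gcongr

/-- Measurability of the crux's one-body observable (continuity). -/
theorem measurable_obs {θ : ℝ} {u₀ : V3} {φ : T3 → ℝ} {g : V3 → ℝ} (hφ : Continuous φ)
    (hg : Continuous g) (N : ℕ) : Measurable (obs θ u₀ φ g N) := by
  refine Continuous.measurable ?_
  unfold obs
  fun_prop

/-- The one-body observable is bounded by `(N+1)·C_φ·C_g`. -/
theorem abs_obs_le {θ Cφ Cg : ℝ} {u₀ : V3} {φ : T3 → ℝ} {g : V3 → ℝ} (hφ : ∀ x, |φ x| ≤ Cφ)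
    (hg : ∀ v, |g v| ≤ Cg) (N : ℕ) (z : Phase N) : |obs θ u₀ φ g N z| ≤ (N + 1) * (Cφ * Cg) := by
  have hCg : 0 ≤ Cg := (abs_nonneg _).trans (hg 0)
  calc |obs θ u₀ φ g N z|
      ≤ ∑ i, |φ (z i).1 * g ((Real.sqrt θ)⁻¹ • ((z i).2 - u₀))| := Finset.abs_sum_le_sum_abs _ _
    _ ≤ ∑ _i : Fin (N + 1), Cφ * Cg := by
        refine Finset.sum_le_sum fun i _ => ?_
        rw [abs_mul]
        exact mul_le_mul (hφ (z i).1) (hg _) (abs_nonneg _) ((abs_nonneg (φ (z i).1)).trans (hφ (z i).1))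
    _ = (N + 1) * (Cφ * Cg) := by simp

/-- **The two regimes glue to an all-`A` envelope at budget `¼` and an absolute horizon** (proved):
`λ := min(λ_away, λ_slow)`, `S := 8/λ`, `η := ¼`; the slow end fixes the hand-off `A₀(¼, S)` and `σ_slow`,
the compactified engine at that `A₀` gives `σ_away`; `σ₀ := min`. -/
theorem allCutoffEnvelope (hE : EnvelopeAwayFromRest) (hS : EnvelopeSlowEnd) :
    ∀ (a θ : ℝ) (u₀ : V3), 0 < a → 0 < θ → ∃ lam : ℝ, 0 < lam ∧
      ∃ σ₀ : ℝ, 0 < σ₀ ∧ ∀ σ : ℝ, 0 < σ → σ < σ₀ →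
      ∀ (e₁ e₂ : V3), inner ℝ e₁ e₂ = 0 → ∀ A : ℝ, 0 < A → ∀ φ : T3 → ℝ, Continuous φ →
      ∃ N₀ : ℕ, ∀ N : ℕ, N₀ ≤ N → ∀ (Φ : Flow σ N) (s t : ℝ), 0 ≤ s → s ≤ t →
        t ≤ (8 / lam) * kineticUnit σ θ N →
        ∫ z, obs θ u₀ φ (cutoffStress e₁ e₂ A) N (Φ.flow t z)
            * obs θ u₀ φ (cutoffStress e₁ e₂ A) N (Φ.flow s z) ∂(gibbs σ a θ u₀ N Φ)
          ≤ ((N : ℝ) + 1) * (∫ x, φ x ^ 2) * gaussNormSq (cutoffStress e₁ e₂ A)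
              * (Real.exp (-(lam * (t - s) / kineticUnit σ θ N)) + 1 / 4) := by
  intro a θ u₀ ha hθ
  obtain ⟨lam₁, hlam₁, H₁⟩ := hE a θ u₀ ha hθ
  obtain ⟨lam₂, hlam₂, H₂⟩ := hS a θ u₀ ha hθ
  have hlam : 0 < min lam₁ lam₂ := lt_min hlam₁ hlam₂
  have hS8 : 0 < 8 / min lam₁ lam₂ := by positivity
  obtain ⟨A₀, hA₀, σ₂, hσ₂, G₂⟩ := H₂ (1 / 4) (8 / min lam₁ lam₂) (by norm_num) hS8
  obtain ⟨σ₁, hσ₁, G₁⟩ := H₁ A₀ (1 / 4) (8 / min lam₁ lam₂) hA₀ (by norm_num) hS8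
  refine ⟨min lam₁ lam₂, hlam, min σ₁ σ₂, lt_min hσ₁ hσ₂, fun σ hσ hσlt e₁ e₂ he A hA φ hφ => ?_⟩
  have hσ₁' : σ < σ₁ := lt_of_lt_of_le hσlt (min_le_left _ _)
  have hσ₂' : σ < σ₂ := lt_of_lt_of_le hσlt (min_le_right _ _)
  -- monotonicity of the envelope in the rate
  have hmono : ∀ {lam' : ℝ} (_ : min lam₁ lam₂ ≤ lam') (N : ℕ) {s t : ℝ}, s ≤ t →
      Real.exp (-(lam' * (t - s) / kineticUnit σ θ N))
        ≤ Real.exp (-(min lam₁ lam₂ * (t - s) / kineticUnit σ θ N)) := by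
    intro lam' hle N s t hst
    have ht₀ : 0 < kineticUnit σ θ N := by
      have : 0 < Real.sqrt θ := Real.sqrt_pos.2 hθ
      positivity
    refine Real.exp_le_exp.2 (neg_le_neg ?_)
    exact div_le_div_of_nonneg_right (mul_le_mul_of_nonneg_right hle (sub_nonneg.2 hst)) ht₀.le
  have hpre : ∀ N : ℕ, 0 ≤ ((N : ℝ) + 1) * (∫ x, φ x ^ 2) * gaussNormSq (cutoffStress e₁ e₂ A) := by
    intro N
    refine mul_nonneg (mul_nonneg (by positivity) (integral_nonneg fun x => sq_nonneg _)) ?_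
    exact integral_nonneg fun v => sq_nonneg _
  rcases le_or_gt A A₀ with hle | hlt
  · obtain ⟨N₀, HN⟩ := G₂ σ hσ hσ₂' e₁ e₂ he A hA hle φ hφ
    refine ⟨N₀, fun N hN Φ s t hs hst ht => (HN N hN Φ s t hs hst ht).trans ?_⟩
    exact mul_le_mul_of_nonneg_left (add_le_add_left (hmono (min_le_right _ _) N hst) _) (hpre N)
  · obtain ⟨N₀, HN⟩ := G₁ σ hσ hσ₁' e₁ e₂ he A hlt.le φ hφ
    refine ⟨N₀, fun N hN Φ s t hs hst ht => (HN N hN Φ s t hs hst ht).trans ?_⟩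
    exact mul_le_mul_of_nonneg_left (add_le_add_left (hmono (min_le_left _ _) N hst) _) (hpre N)

/-- **Composition of the line** (proved): the all-`A` envelope at budget `¼` over the absolute horizon
`S = 8/λ` (kinetic units), fed — in flow time, rate `λ/t₀`, horizon `h = S·t₀ = τ(N+1)^{-1/3}` with
`τ := S/(σ²√θ)` — to the window lemma, and normalised by the exact static variance, IS the crux:
`E[F²](2/(λS) + ¼) = ½ (N+1)∫φ²∫g_A²dγ`. Clause (A) by the tree theorem `isProbabilityMeasure_localGibbsLaw`
(`σ₀ ≤ ½`); joint measurability by `HardSphereFlow.measurable_flow_prod_torus` on the `G_N`-conull good set. -/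
theorem shearStressHalfDrude_of_parts (hW : WindowBudget) (hV : StaticShearVariance)
    (hE : EnvelopeAwayFromRest) (hS : EnvelopeSlowEnd) :
    ∀ (a θ : ℝ) (u₀ : V3), 0 < a → 0 < θ → ∃ σ₀ : ℝ, 0 < σ₀ ∧ ∀ σ : ℝ, 0 < σ → σ < σ₀ →
      (∀ (N : ℕ) (Φ : Flow σ N), IsProbabilityMeasure (gibbs σ a θ u₀ N Φ)) ∧
      ∀ (e₁ e₂ : V3), inner ℝ e₁ e₂ = 0 → ∀ A : ℝ, 0 < A → ∀ g : V3 → ℝ,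
        (g = fun w => inner ℝ e₁ w * inner ℝ e₂ w * (1 - Real.smoothTransition (‖w‖ ^ 2 / A ^ 2 - 1))) →
        ∀ φ : T3 → ℝ, Continuous φ → ∃ τ : ℝ, 0 < τ ∧ ∃ N₀ : ℕ, ∀ N : ℕ, N₀ ≤ N → ∀ Φ : Flow σ N,
          ∫⁻ z, ENNReal.ofReal (((τ * ((N + 1 : ℕ) : ℝ) ^ (-(1 / 3 : ℝ)))⁻¹ *
              ∫ s in (0 : ℝ)..(τ * ((N + 1 : ℕ) : ℝ) ^ (-(1 / 3 : ℝ))),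
                ∑ i, φ (Φ.flow s z i).1 * g ((Real.sqrt θ)⁻¹ • ((Φ.flow s z i).2 - u₀))) ^ 2)
              ∂(gibbs σ a θ u₀ N Φ)
            ≤ ENNReal.ofReal ((1 / 2) * (((N : ℝ)) + 1) * (∫ x, φ x ^ 2) *
                ∫ v, g v ^ 2 ∂(stdGaussian V3)) := by
  intro a θ u₀ ha hθ
  obtain ⟨lam, hlam, σ₁, hσ₁, H⟩ := allCutoffEnvelope hE hS a θ u₀ ha hθ
  refine ⟨min σ₁ (1 / 2), lt_min hσ₁ (by norm_num), fun σ hσ hσlt => ?_⟩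
  have hσ₁' : σ < σ₁ := lt_of_lt_of_le hσlt (min_le_left _ _)
  have hσhalf : σ ≤ 1 / 2 := (lt_of_lt_of_le hσlt (min_le_right _ _)).le
  have hP : ∀ (N : ℕ) (Φ : Flow σ N), IsProbabilityMeasure (gibbs σ a θ u₀ N Φ) := fun N Φ =>
    Literature.MathematicalPhysics.KineticTheory.isProbabilityMeasure_localGibbsLaw
      continuous_const continuous_const continuous_const (fun _ => ha) (fun _ => hθ) hσhalf N Φ
  refine ⟨hP, fun e₁ e₂ he A hA g hg φ hφ => ?_⟩
  subst hg
  have hsq : 0 < Real.sqrt θ := Real.sqrt_pos.2 hθ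
  have hτ : 0 < 8 / lam / (σ ^ 2 * Real.sqrt θ) := by positivity
  refine ⟨8 / lam / (σ ^ 2 * Real.sqrt θ), hτ, ?_⟩
  obtain ⟨N₀, HN⟩ := H σ hσ hσ₁' e₁ e₂ he A hA φ hφ
  refine ⟨N₀, fun N hN Φ => ?_⟩
  haveI := hP N Φ
  -- abbreviations
  have ht₀ : 0 < kineticUnit σ θ N := by positivity
  have hh : 8 / lam / (σ ^ 2 * Real.sqrt θ) * ((N + 1 : ℕ) : ℝ) ^ (-(1 / 3 : ℝ))
      = 8 / lam * kineticUnit σ θ N := by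
    simp only [kineticUnit]; ring
  have hFm : Measurable (obs θ u₀ φ (cutoffStress e₁ e₂ A) N) :=
    measurable_obs hφ (continuous_cutoffStress e₁ e₂ A) N
  obtain ⟨Cφ, -, hCφ⟩ := Literature.MathematicalPhysics.KineticTheory.exists_forall_abs_le_of_continuous hφ
  have hFb : ∃ C : ℝ, ∀ z, |obs θ u₀ φ (cutoffStress e₁ e₂ A) N z| ≤ C :=
    ⟨(N + 1) * (Cφ * (2 * A ^ 2 * (‖e₁‖ * ‖e₂‖))), abs_obs_le hCφ (abs_cutoffStress_le e₁ e₂ hA) N⟩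
  have hG : ∃ G : Set (Phase N), MeasurableSet G ∧ gibbs σ a θ u₀ N Φ Gᶜ = 0 ∧
      Measurable fun p : G × ℝ => Φ.flow p.2 (p.1 : Phase N) := by
    refine ⟨Φ.good, Φ.measurableSet_good, ?_, Φ.measurable_flow_prod_torus⟩
    have hac : gibbs σ a θ u₀ N Φ ≪ Literature.Analysis.FluidPDE.liouville
        (Literature.Analysis.FluidPDE.Torus.geometry (Fin 3)) (N + 1) (hsDiameter σ N) :=
      withDensity_absolutelyContinuous _ _
    exact hac Φ.measure_compl_good
  have hV' := hV a θ u₀ ha hθ σ hσ hσhalf N Φ e₁ e₂ he A hA φ hφ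
  -- the envelope in flow time
  have henv : ∀ s t : ℝ, 0 ≤ s → s ≤ t → t ≤ 8 / lam * kineticUnit σ θ N →
      ∫ z, obs θ u₀ φ (cutoffStress e₁ e₂ A) N (Φ.flow t z)
          * obs θ u₀ φ (cutoffStress e₁ e₂ A) N (Φ.flow s z) ∂(gibbs σ a θ u₀ N Φ)
        ≤ (∫ z, obs θ u₀ φ (cutoffStress e₁ e₂ A) N z ^ 2 ∂(gibbs σ a θ u₀ N Φ))
            * (Real.exp (-(lam / kineticUnit σ θ N * (t - s))) + 1 / 4) := by
    intro s t hs hst ht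
    rw [hV']
    rw [div_mul_eq_mul_div]
    exact HN N hN Φ s t hs hst ht
  have hWB := hW (Phase N) (gibbs σ a θ u₀ N Φ) Φ.flow (obs θ u₀ φ (cutoffStress e₁ e₂ A) N) hFm hFb hG
    (lam / kineticUnit σ θ N) (1 / 4) (8 / lam * kineticUnit σ θ N) (div_pos hlam ht₀) (by norm_num)
    (mul_pos (by positivity) ht₀) henv
  rw [hh]
  refine hWB.trans (le_of_eq ?_)
  congr 1
  rw [hV']
  simp only [gaussNormSq]
  field_simp
  ring

/-- **The skeleton concludes the crux BY NAME.** `ShearStressHalfDrude` (route `AntiMazurCoboundaries`,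
stmt-AtomisticToContinuum-14136) from the six registered stubs. -/
theorem ShearStressHalfDrude_of : ShearStressHalfDrude :=
  shearStressHalfDrude_of_parts stub_windowBudget stub_staticShearVariance
    (stub_cutoffCompactification (stub_frozenModulation stub_flatEnvelope)) stub_slowEndEnvelope

end Summit.AtomisticToContinuum.HydrodynamicLimit.Cruxes.ShearStressHalfDrude.FixedBudgetSignedHierarchy

end
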